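import Summits.RiemannHypothesis.RiemannHypothesis.Theorems.WeilTwoPrimeDeflM80PDef
import Summits.RiemannHypothesis.RiemannHypothesis.Theorems.WeilTwoPrimeDeflM80PDataPE33
import Literature.NumberTheory.LFunctions.WeilBlockRowsR
import HarnessLib

/-!
# Even-sector deflated two-prime certificate M80P: the materialized even block agrees with `P_r + Σ μ ĉ ĉᵀ`, rows 100–109

`WeilCert.checkPmRowG` for certificate M80P (even block), by `decide +kernel`. Pure proof file; nothing is asserted.
-/

set_option linter.dupNamespace false

noncomputable section

namespace Summit.RiemannHypothesis.RiemannHypothesis.Theorems.EvenWinsBeyondArch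

open Literature.NumberTheory.LFunctions

set_option maxHeartbeats 0 in
/-- Row 100 of the materialized even block is row 100 of `P_r + Σ μ ĉ ĉᵀ` (certificate M80P). [folklore] -/
theorem checkPmRowG0_100_weilCertDeflM80P : weilCertDeflM80PBase.checkPmRowG weilCertDeflM80PP weilCertDeflM80PPmE 0 100 = true := by
  decide +kernel

set_option maxHeartbeats 0 in
/-- Row 101 of the materialized even block is row 101 of `P_r + Σ μ ĉ ĉᵀ` (certificate M80P). [folklore] -/
theorem checkPmRowG0_101_weilCertDeflM80P : weilCertDeflM80PBase.checkPmRowG weilCertDeflM80PP weilCertDeflM80PPmE 0 101 = true := by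
  decide +kernel

set_option maxHeartbeats 0 in
/-- Row 102 of the materialized even block is row 102 of `P_r + Σ μ ĉ ĉᵀ` (certificate M80P). [folklore] -/
theorem checkPmRowG0_102_weilCertDeflM80P : weilCertDeflM80PBase.checkPmRowG weilCertDeflM80PP weilCertDeflM80PPmE 0 102 = true := by
  decide +kernel

set_option maxHeartbeats 0 in
/-- Row 103 of the materialized even block is row 103 of `P_r + Σ μ ĉ ĉᵀ` (certificate M80P). [folklore] -/
theorem checkPmRowG0_103_weilCertDeflM80P : weilCertDeflM80PBase.checkPmRowG weilCertDeflM80PP weilCertDeflM80PPmE 0 103 = true := by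
  decide +kernel

set_option maxHeartbeats 0 in
/-- Row 104 of the materialized even block is row 104 of `P_r + Σ μ ĉ ĉᵀ` (certificate M80P). [folklore] -/
theorem checkPmRowG0_104_weilCertDeflM80P : weilCertDeflM80PBase.checkPmRowG weilCertDeflM80PP weilCertDeflM80PPmE 0 104 = true := by
  decide +kernel

set_option maxHeartbeats 0 in
/-- Row 105 of the materialized even block is row 105 of `P_r + Σ μ ĉ ĉᵀ` (certificate M80P). [folklore] -/
theorem checkPmRowG0_105_weilCertDeflM80P : weilCertDeflM80PBase.checkPmRowG weilCertDeflM80PP weilCertDeflM80PPmE 0 105 = true := by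
  decide +kernel

set_option maxHeartbeats 0 in
/-- Row 106 of the materialized even block is row 106 of `P_r + Σ μ ĉ ĉᵀ` (certificate M80P). [folklore] -/
theorem checkPmRowG0_106_weilCertDeflM80P : weilCertDeflM80PBase.checkPmRowG weilCertDeflM80PP weilCertDeflM80PPmE 0 106 = true := by
  decide +kernel

set_option maxHeartbeats 0 in
/-- Row 107 of the materialized even block is row 107 of `P_r + Σ μ ĉ ĉᵀ` (certificate M80P). [folklore] -/
theorem checkPmRowG0_107_weilCertDeflM80P : weilCertDeflM80PBase.checkPmRowG weilCertDeflM80PP weilCertDeflM80PPmE 0 107 = true := by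
  decide +kernel

set_option maxHeartbeats 0 in
/-- Row 108 of the materialized even block is row 108 of `P_r + Σ μ ĉ ĉᵀ` (certificate M80P). [folklore] -/
theorem checkPmRowG0_108_weilCertDeflM80P : weilCertDeflM80PBase.checkPmRowG weilCertDeflM80PP weilCertDeflM80PPmE 0 108 = true := by
  decide +kernel

set_option maxHeartbeats 0 in
/-- Row 109 of the materialized even block is row 109 of `P_r + Σ μ ĉ ĉᵀ` (certificate M80P). [folklore] -/
theorem checkPmRowG0_109_weilCertDeflM80P : weilCertDeflM80PBase.checkPmRowG weilCertDeflM80PP weilCertDeflM80PPmE 0 109 = true := by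
  decide +kernel


end Summit.RiemannHypothesis.RiemannHypothesis.Theorems.EvenWinsBeyondArch
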